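import Mathlib
import Literature.MathematicalPhysics.StatisticalMechanics.HaggStacking

/-!
# Route `HolmgrenBoyleLind`, crux `HalfSpaceUniqueContinuation`: symbolic dynamics of Hägg
sequences — a non-periodic sequence has an asymptotic pair
Support file for the crux item stmt-AtomisticToContinuum-6075 (`HalfSpaceUniqueContinuation`,
line `registered`, lead c1): the combinatorial input of «every Barlow stacking in exact
Lennard-Jones force balance is periodic» (the Barlow class of the registered rank-2 stub
`stub_layeredOpenVanishing`; next file).

* `hbl_hagg_periodic_of_finite_memory` — if the present letter of a `±1` sequence is determined
  by its `N` preceding letters, the sequence is periodic (pigeonhole on windows, period `∣ (2^N)!`);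
* `hbl_hagg_exists_asymptotic_pair` — a NON-periodic `±1` sequence `s` has two sequences `x, y`
  in its orbit closure (every centred window of each occurs in `s`) with the same past
  (`x k = y k`, `k < 0`) and different present (`x 0 ≠ y 0`): compactness of `{±1}^ℤ`.
All `[folklore]`; nothing here closes an item.
-/

noncomputable section

namespace Summit.AtomisticToContinuum.Crystallization.Theorems.HolmgrenBoyleLind

open Filter Topology
open Literature.MathematicalPhysics.StatisticalMechanics

/-- **Finite memory forces periodicity.** If a `±1` sequence satisfies
`s m = s m'` whenever the `N` letters before `m` and before `m'` agree, then it is periodic.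
Pigeonhole: among `2^N + 1` consecutive windows two agree, and agreement propagates forward, so
`s` is `p`-periodic (`p ≤ 2^N`) from any level on; with `P = (2^N)!` it is `P`-periodic
everywhere. [folklore] -/
theorem hbl_hagg_periodic_of_finite_memory {s : ℤ → ℤ} (hs : IsHaggSeq s) {N : ℕ}
    (hmem : ∀ m m' : ℤ, (∀ j : ℕ, j < N → s (m - 1 - j) = s (m' - 1 - j)) → s m = s m') :
    ∃ p : ℕ, 0 < p ∧ ∀ k : ℤ, s (k + p) = s k := by
  classical
  -- forward propagation of window agreement
  have hprop : ∀ m m' : ℤ, (∀ j : ℕ, j < N → s (m - 1 - j) = s (m' - 1 - j)) →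
      ∀ i : ℕ, s (m + i) = s (m' + i) := by
    intro m m' hw i
    -- strengthen: the windows before `m + i`, `m' + i` agree, by induction on `i`
    have key : ∀ i : ℕ, ∀ j : ℕ, j < N + i → s (m + i - 1 - j) = s (m' + i - 1 - j) := by
      intro i
      induction i with
      | zero =>
        intro j hj
        simpa using hw j (by omega)
      | succ i ih =>
        intro j hj
        rcases Nat.eq_zero_or_pos j with rfl | hj0
        · have h1 : s (m + i) = s (m' + i) :=
            hmem (m + i) (m' + i) fun j' hj' => by
              have := ih j' (by omega)
              convert this using 2
          convert h1 using 2 <;> push_cast <;> ring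
        · have := ih (j - 1) (by omega)
          convert this using 2 <;> push_cast <;> omega
    have h := hmem (m + i) (m' + i) fun j hj => by
      have := key i j (by omega)
      convert this using 2
    exact h
  -- windows as Boolean vectors; pigeonhole below any level `M`
  let W : ℤ → (Fin N → Bool) := fun m j => decide (s (m - 1 - j) = 1)
  have hWeq : ∀ m m' : ℤ, W m = W m' → ∀ j : ℕ, j < N → s (m - 1 - j) = s (m' - 1 - j) := by
    intro m m' hW j hj
    have h1 : W m ⟨j, hj⟩ = W m' ⟨j, hj⟩ := by rw [hW]
    simp only [W, decide_eq_decide] at h1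
    rcases hs (m - 1 - j) with h2 | h2 <;> rcases hs (m' - 1 - j) with h3 | h3 <;>
      simp_all
  have hloc : ∀ M : ℤ, ∃ p : ℕ, 0 < p ∧ p ≤ 2 ^ N ∧ ∀ k : ℤ, M ≤ k → s (k + p) = s k := by
    intro M
    obtain ⟨j₁, j₂, hne, heq⟩ := Fintype.exists_ne_map_eq_of_card_lt
      (fun j : Fin (2 ^ N + 1) => W (M - j)) (by simp)
    -- order the two indices
    wlog hlt : (j₁ : ℕ) < j₂ generalizing j₁ j₂
    · exact this j₂ j₁ hne.symm heq.symm (by omega)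
    refine ⟨j₂ - j₁, by omega, by omega, fun k hk => ?_⟩
    have hw := hWeq _ _ heq.symm
    -- propagate from `M - j₂` (and `M - j₁`) forward by `i = k - (M - j₂)`
    have hi : ∃ i : ℕ, k = M - j₂ + i := ⟨(k - (M - j₂)).toNat, by omega⟩
    obtain ⟨i, rfl⟩ := hi
    have h := hprop (M - j₂) (M - j₁) hw i
    convert h.symm using 2
    omega
  -- a global period: `(2^N)!`
  refine ⟨(2 ^ N).factorial, Nat.factorial_pos _, fun k => ?_⟩
  obtain ⟨p, hp0, hple, hper⟩ := hloc k
  have hdvd : p ∣ (2 ^ N).factorial := Nat.dvd_factorial hp0 hple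
  obtain ⟨q, hq⟩ := hdvd
  have hiter : ∀ n : ℕ, s (k + n * p) = s k := by
    intro n
    induction n with
    | zero => simp
    | succ n ih =>
      have h1 := hper (k + n * p) (by have : (0 : ℤ) ≤ n * p := (by positivity); linarith)
      rw [← ih, ← h1]
      congr 1
      push_cast
      ring
  have := hiter q
  rw [hq]
  convert this using 2
  push_cast
  ring

/-- **A non-periodic `±1` sequence has an asymptotic pair in its orbit closure.** If the Hägg
sequence `s` is not periodic, there are `±1` sequences `x, y`, every centred window of each of
which occurs in `s`, with `x k = y k` for all `k < 0` and `x 0 ≠ y 0`. (Not periodic ⇒ no finite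
memory (`hbl_hagg_periodic_of_finite_memory`) ⇒ for every `N` two positions with equal `N`-pasts
and different presents; a diagonal subsequence of the recentred sequences converges letterwise in
the compact space `{±1}^ℤ`.) [folklore] -/
theorem hbl_hagg_exists_asymptotic_pair :
    ∀ (s : ℤ → ℤ), IsHaggSeq s → (¬ ∃ p : ℕ, 0 < p ∧ ∀ k : ℤ, s (k + p) = s k) →
      ∃ x y : ℤ → ℤ, IsHaggSeq x ∧ IsHaggSeq y ∧
        (∀ N : ℕ, ∃ m : ℤ, ∀ k : ℤ, |k| ≤ N → x k = s (m + k)) ∧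
        (∀ N : ℕ, ∃ m : ℤ, ∀ k : ℤ, |k| ≤ N → y k = s (m + k)) ∧
        (∀ k : ℤ, k < 0 → x k = y k) ∧ x 0 ≠ y 0 := by
  intro s hs hnp
  classical
  -- witnesses against finite memory, normalised so that the first present letter is `1`
  have hW : ∀ N : ℕ, ∃ m m' : ℤ, (∀ j : ℕ, j < N → s (m - 1 - j) = s (m' - 1 - j)) ∧
      s m = 1 ∧ s m' = -1 := by
    intro N
    by_contra hno
    push Not at hno
    refine hnp (hbl_hagg_periodic_of_finite_memory hs (N := N) fun m m' hw => ?_)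
    rcases hs m with h1 | h1 <;> rcases hs m' with h2 | h2
    · rw [h1, h2]
    · exact absurd h2 (hno m m' hw h1)
    · exact absurd h1 (hno m' m (fun j hj => (hw j hj).symm) h2)
    · rw [h1, h2]
  choose μ μ' hpast hμ hμ' using hW
  -- the compact alphabet and the recentred sequences
  have hS : ∀ z : ℤ, z = 1 ∨ z = -1 → z ∈ ({1, -1} : Finset ℤ) := fun z hz => by
    rcases hz with rfl | rfl <;> simp
  letI : TopologicalSpace (↥({1, -1} : Finset ℤ)) := ⊥
  haveI : DiscreteTopology (↥({1, -1} : Finset ℤ)) := ⟨rfl⟩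
  haveI : CompactSpace (↥({1, -1} : Finset ℤ)) := Finite.compactSpace
  let v : ℕ → (ℤ → ↥({1, -1} : Finset ℤ)) × (ℤ → ↥({1, -1} : Finset ℤ)) := fun N =>
    (fun k => ⟨s (μ N + k), hS _ (hs _)⟩, fun k => ⟨s (μ' N + k), hS _ (hs _)⟩)
  obtain ⟨⟨x, y⟩, φ, hφ, hlim⟩ := CompactSpace.tendsto_subseq v
  -- letterwise eventual constancy
  have hx : ∀ k : ℤ, ∀ᶠ i in atTop, (v (φ i)).1 k = x k := by
    intro k
    have h1 := ((continuous_apply k).tendsto x).comp ((continuous_fst.tendsto _).comp hlim)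
    rw [nhds_discrete] at h1
    exact tendsto_pure.1 h1
  have hy : ∀ k : ℤ, ∀ᶠ i in atTop, (v (φ i)).2 k = y k := by
    intro k
    have h1 := ((continuous_apply k).tendsto y).comp ((continuous_snd.tendsto _).comp hlim)
    rw [nhds_discrete] at h1
    exact tendsto_pure.1 h1
  have hφge : ∀ i, i ≤ φ i := fun i => hφ.id_le i
  refine ⟨fun k => (x k : ℤ), fun k => (y k : ℤ), fun k => ?_, fun k => ?_, fun N => ?_,
    fun N => ?_, fun k hk => ?_, ?_⟩
  · have h := (x k).2
    simp only [Finset.mem_insert, Finset.mem_singleton] at h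
    exact h
  · have h := (y k).2
    simp only [Finset.mem_insert, Finset.mem_singleton] at h
    exact h
  · -- centred windows of `x` occur in `s`
    have hall : ∀ᶠ i in atTop, ∀ k ∈ Finset.Icc (-(N : ℤ)) N, (v (φ i)).1 k = x k :=
      (Finset.eventually_all _).2 fun k _ => hx k
    obtain ⟨i, hi⟩ := hall.exists
    refine ⟨μ (φ i), fun k hk => ?_⟩
    have h := hi k (by rw [Finset.mem_Icc]; constructor <;> linarith [abs_le.1 hk |>.1, abs_le.1 hk |>.2])
    beta_reduce
    rw [← h]
  · have hall : ∀ᶠ i in atTop, ∀ k ∈ Finset.Icc (-(N : ℤ)) N, (v (φ i)).2 k = y k :=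
      (Finset.eventually_all _).2 fun k _ => hy k
    obtain ⟨i, hi⟩ := hall.exists
    refine ⟨μ' (φ i), fun k hk => ?_⟩
    have h := hi k (by rw [Finset.mem_Icc]; constructor <;> linarith [abs_le.1 hk |>.1, abs_le.1 hk |>.2])
    beta_reduce
    rw [← h]
  · -- same past
    have hev : ∀ᶠ i in atTop, (v (φ i)).1 k = x k ∧ (v (φ i)).2 k = y k ∧ (-k).toNat ≤ i :=
      (hx k).and ((hy k).and (eventually_ge_atTop _))
    obtain ⟨i, h1, h2, h3⟩ := hev.exists
    have hj : (-k - 1).toNat < φ i := by have := hφge i; omega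
    have h4 := hpast (φ i) (-k - 1).toNat hj
    have e1 : μ (φ i) - 1 - ((-k - 1).toNat : ℕ) = μ (φ i) + k := by omega
    have e2 : μ' (φ i) - 1 - ((-k - 1).toNat : ℕ) = μ' (φ i) + k := by omega
    rw [e1, e2] at h4
    have h5 : (v (φ i)).1 k = (v (φ i)).2 k := Subtype.ext h4
    beta_reduce
    rw [← h1, ← h2, h5]
  · -- different present
    obtain ⟨i, h1, h2⟩ := ((hx 0).and (hy 0)).exists
    have e1 : ((v (φ i)).1 0 : ℤ) = 1 := by simp [v, hμ]
    have e2 : ((v (φ i)).2 0 : ℤ) = -1 := by simp [v, hμ']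
    beta_reduce
    rw [← h1, ← h2, e1, e2]
    norm_num

end Summit.AtomisticToContinuum.Crystallization.Theorems.HolmgrenBoyleLind

end
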